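import Summits.SmoothPoincare4.SmoothPoincare4.Theses.InformationMetricHadamard

/-!
# Stub `stub_nearestPointSpread` of line `core-distance-morse` — auxiliary file 1: the horizontal budget
(crux `InformationMetricHadamard.C0AhRecognition`, stmt-SmoothPoincare4-6015)

The Minkowski step of the first lemma `NearestPointSpread` (the `√2`-spread of nearest points):
for an end collar `Ψ : N × (0,1) → W⁵` whose metric `G ∘ dΨ` is within a factor `1 ± ε` of the
cone `c (dl² + gN)/l²` below height `t`, a deep `C¹` path `β = (x, λ)` below level `s` with
`G`-length of `Ψ ∘ β` at most `L` moves its cross-section coordinate by at most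
`s (r L − κ ℓ)/(κ √(r² − 1))` in `gN`-distance (`κ = √((1−ε)c)`, `ℓ = log(λ(b)/λ(a))`, any `r > 1`):
test the pointwise speed bound `κ √(p² + q²) ≤ |(Ψ ∘ β)'|_G` (`p = |λ'|/λ`, `q = |x'|_{gN}/λ`)
against the unit vector `(1/r, √(r²−1)/r)` and integrate.

* `NearestPointSpread.sub_mul_le_of_abs_sub_le`, `NearestPointSpread.val_self_nonneg`,
  `NearestPointSpread.log_div_le_integral_abs_deriv_div'`,
  `NearestPointSpread.mul_add_mul_le_sqrt_sq_add_sq'` — elementary ingredients;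
* `helper_nearestPointSpread_minkowski` — the registered helper (horizontal budget).

Adapted from the lead's groundwork `Cruxes/C0AhRecognition/PrepCollarLengthBounds.lean` (not
importable from `Theorems`). Everything is proved (kind = proof); no definitions.
-/

noncomputable section

-- the prescribed namespace `Summit.<P>.<Sub>.…` duplicates `SmoothPoincare4` (P = Sub)
set_option linter.dupNamespace false

open scoped Manifold ContDiff Topology ENNReal NNReal
open Set Function MeasureTheory

namespace Summit.SmoothPoincare4.SmoothPoincare4.Cruxes.C0AhRecognition.CoreDistanceMorse

open Literature.Geometry.Lorentzian (PseudoRiemannianMetric)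

namespace NearestPointSpread

variable {N : Type} [TopologicalSpace N] [ChartedSpace (EuclideanSpace ℝ (Fin 4)) N]
  [IsManifold (𝓡 4) ∞ N]

/-- **Lower reading of the asymptotics clause.** If `|G(dΨ(v,σ), dΨ(v,σ)) − A| ≤ ε A` with
`A = c(σ² + gN(v,v))/l²`, then `(1 − ε) A ≤ G(dΨ(v,σ), dΨ(v,σ))`. [folklore] -/
theorem sub_mul_le_of_abs_sub_le {X A ε : ℝ} (h : |X - A| ≤ ε * A) : (1 - ε) * A ≤ X := by
  have h2 := (abs_sub_le_iff.1 h).2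
  linarith

-- adapted from Cruxes/C0AhRecognition/PrepCollarLengthBounds.lean
/-- A Riemannian (positive definite) pseudo-Riemannian metric has nonnegative squares. [folklore] -/
theorem val_self_nonneg
    (gN : PseudoRiemannianMetric (𝓡 4) ∞ (EuclideanSpace ℝ (Fin 4)) (TangentSpace (𝓡 4) : N → Type _))
    (hgN : gN.IsRiemannian) (y : N) (v : TangentSpace (𝓡 4) y) : 0 ≤ gN.val y v v := by
  by_cases hv : v = 0
  · subst hv; simp
  · exact (hgN y v hv).le

-- adapted from Cruxes/C0AhRecognition/PrepCollarLengthBounds.lean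
/-- For `λ` continuous on `[a,b]`, differentiable on `(a,b)` with interval-integrable derivative,
and positive on `[a,b]` (`a ≤ b`): `log (λ b / λ a) ≤ ∫_a^b |λ'|/λ`. [folklore] -/
theorem log_div_le_integral_abs_deriv_div' {a b : ℝ} (hab : a ≤ b) {lam lam' : ℝ → ℝ}
    (hcont : ContinuousOn lam (Icc a b)) (hderiv : ∀ t ∈ Ioo a b, HasDerivAt lam (lam' t) t)
    (hcont' : ContinuousOn lam' (Icc a b)) (hpos : ∀ t ∈ Icc a b, 0 < lam t) :
    Real.log (lam b / lam a) ≤ ∫ t in a..b, |lam' t| / lam t := by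
  have hlog : ∀ t ∈ Ioo a b, HasDerivAt (fun u ↦ Real.log (lam u)) (lam' t / lam t) t :=
    fun t ht ↦ (hderiv t ht).log (hpos t (Ioo_subset_Icc_self ht)).ne'
  have hquot : ContinuousOn (fun t ↦ lam' t / lam t) (Icc a b) :=
    hcont'.div hcont fun t ht ↦ (hpos t ht).ne'
  have hint : IntervalIntegrable (fun t ↦ lam' t / lam t) volume a b :=
    (hquot.mono (by rw [uIcc_of_le hab])).intervalIntegrable
  have hlogc : ContinuousOn (fun u ↦ Real.log (lam u)) (Icc a b) :=
    hcont.log fun t ht ↦ (hpos t ht).ne'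
  have hftc : ∫ t in a..b, lam' t / lam t = Real.log (lam b) - Real.log (lam a) :=
    intervalIntegral.integral_eq_sub_of_hasDerivAt_of_le hab hlogc hlog hint
  rw [Real.log_div (hpos b ⟨hab, le_rfl⟩).ne' (hpos a ⟨le_rfl, hab⟩).ne', ← hftc]
  refine intervalIntegral.integral_mono_on hab hint ?_ fun t ht ↦ ?_
  · exact (((continuous_abs.comp_continuousOn hcont').div hcont fun t ht ↦ (hpos t ht).ne').mono
      (by rw [uIcc_of_le hab])).intervalIntegrable
  · exact div_le_div_of_nonneg_right (le_abs_self _) (hpos t ht).le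

-- adapted from Cruxes/C0AhRecognition/PrepCollarLengthBounds.lean
/-- Pointwise Cauchy–Schwarz in the plane: for `α² + β² ≤ 1`, `α p + β q ≤ √(p² + q²)`. [folklore] -/
theorem mul_add_mul_le_sqrt_sq_add_sq' {α β : ℝ} (h : α ^ 2 + β ^ 2 ≤ 1) (p q : ℝ) :
    α * p + β * q ≤ Real.sqrt (p ^ 2 + q ^ 2) := by
  by_cases hs : α * p + β * q ≤ 0
  · exact hs.trans (Real.sqrt_nonneg _)
  · push Not at hs
    refine Real.le_sqrt_of_sq_le ?_
    have hpq : 0 ≤ p ^ 2 + q ^ 2 := by positivity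
    nlinarith [sq_nonneg (α * q - β * p), mul_le_mul_of_nonneg_right h hpq]

end NearestPointSpread

open NearestPointSpread in
-- adapted from Cruxes/C0AhRecognition/PrepCollarLengthBounds.lean (`edist_fst_le_of_length_le`)
/-- **Horizontal budget (the Minkowski step of `NearestPointSpread`, measurability-free form).**
Let the asymptotics clause hold with `ε < 1` below height `t ≤ 1`, `κ := √((1−ε)c)`, and let
`β = (x, λ) : ℝ → N × ℝ` be `C¹` on an open `U ⊇ [a,b]`, deep (`λ ∈ (0,t)`), below level `s`
(`λ ≤ s`) and climbing (`λ(a) ≤ λ(b)`), with `G`-length of `Ψ ∘ β` at most `L`. Then for every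
`r > 1` the `gN`-distance between the endpoints' cross-section coordinates is at most
`s · (r L − κ ℓ) / (κ √(r² − 1))`, `ℓ = log(λ(b)/λ(a))`. Proof: test the pointwise speed bound
`κ √(p² + q²) ≤ |γ'|_G` (`p = |λ'|/λ`, `q = |x'|_{gN}/λ`) against the unit vector
`(1/r, √(r²−1)/r)`, integrate (only the vertical term needs measurability), use `∫ p ≥ ℓ`, and
`|x'|_{gN} = λ q ≤ s q`. [folklore] -/
theorem helper_nearestPointSpread_minkowski
    (N : Type) [TopologicalSpace N] [ChartedSpace (EuclideanSpace ℝ (Fin 4)) N] [IsManifold (𝓡 4) ∞ N]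
    (gN : PseudoRiemannianMetric (𝓡 4) ∞ (EuclideanSpace ℝ (Fin 4)) (TangentSpace (𝓡 4) : N → Type _))
    (hgN : gN.IsRiemannian)
    (W : Type) [TopologicalSpace W] [ChartedSpace (EuclideanSpace ℝ (Fin 5)) W] [IsManifold (𝓡 5) ∞ W]
    (G : PseudoRiemannianMetric (𝓡 5) ∞ (EuclideanSpace ℝ (Fin 5)) (TangentSpace (𝓡 5) : W → Type _))
    (hG : G.IsRiemannian) (c : ℝ) (Ψ : N × ℝ → W) (hc : 0 < c)
    (hsm : ContMDiffOn ((𝓡 4).prod 𝓘(ℝ, ℝ)) (𝓡 5) ∞ Ψ (univ ×ˢ Ioo (0 : ℝ) 1))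
    (ε t : ℝ) (hε : ε < 1) (ht1 : t ≤ 1)
    (hasym : ∀ (y : N) (l : ℝ), l ∈ Ioo (0 : ℝ) t → ∀ (v : TangentSpace (𝓡 4) y) (σ : ℝ),
      |G.val (Ψ (y, l)) (mfderiv ((𝓡 4).prod 𝓘(ℝ, ℝ)) (𝓡 5) Ψ (y, l) (v, σ))
          (mfderiv ((𝓡 4).prod 𝓘(ℝ, ℝ)) (𝓡 5) Ψ (y, l) (v, σ)) -
        c * (σ ^ 2 + gN.val y v v) / l ^ 2| ≤ ε * (c * (σ ^ 2 + gN.val y v v) / l ^ 2))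
    (β : ℝ → N × ℝ) (U : Set ℝ) (hU : IsOpen U) (a b : ℝ) (hab : a ≤ b) (hIU : Icc a b ⊆ U)
    (hβ : ContMDiffOn 𝓘(ℝ, ℝ) ((𝓡 4).prod 𝓘(ℝ, ℝ)) 1 β U)
    (hdeep : ∀ τ ∈ Icc a b, (β τ).2 ∈ Ioo (0 : ℝ) t) (s : ℝ) (hle : ∀ τ ∈ Icc a b, (β τ).2 ≤ s)
    (hclimb : (β a).2 ≤ (β b).2) (L : ℝ)
    (hL : G.length hG (Ψ ∘ β) a b ≤ ENNReal.ofReal L) (r : ℝ) (hr : 1 < r) :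
    gN.edist hgN (β a).1 (β b).1 ≤ ENNReal.ofReal
      (s * (r * L - Real.sqrt ((1 - ε) * c) * Real.log ((β b).2 / (β a).2)) /
        (Real.sqrt ((1 - ε) * c) * Real.sqrt (r ^ 2 - 1))) := by
  -- notation
  set κ : ℝ := Real.sqrt ((1 - ε) * c) with hκ
  set ρ : ℝ := Real.sqrt (r ^ 2 - 1) with hρ
  set ℓ : ℝ := Real.log ((β b).2 / (β a).2) with hℓ
  have h1ε : 0 < 1 - ε := by linarith
  have hκ0 : 0 < κ := Real.sqrt_pos.2 (by positivity)
  have hκsq : κ ^ 2 = (1 - ε) * c := Real.sq_sqrt (by positivity)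
  have hr0 : 0 < r := one_pos.trans hr
  have hρ0 : 0 < ρ := Real.sqrt_pos.2 (by nlinarith)
  have hρsq : ρ ^ 2 = r ^ 2 - 1 := Real.sq_sqrt (by nlinarith)
  have hunit : (1 / r) ^ 2 + (ρ / r) ^ 2 ≤ 1 := by
    rw [div_pow, div_pow, hρsq, ← add_div, one_pow, div_le_one (by positivity)]
    linarith
  have hpos : ∀ τ ∈ Icc a b, 0 < (β τ).2 := fun τ hτ ↦ (hdeep τ hτ).1
  have hℓ0 : 0 ≤ ℓ := Real.log_nonneg ((one_le_div (hpos a ⟨le_rfl, hab⟩)).2 hclimb)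
  -- the height and its derivative (as in `log_le_length_comp`)
  set lam : ℝ → ℝ := fun τ ↦ (β τ).2 with hlam
  have hlam_cd : ContDiffOn ℝ 1 lam U :=
    contMDiffOn_iff_contDiffOn.1 (contMDiff_snd.comp_contMDiffOn hβ)
  have hlam_cont : ContinuousOn lam (Icc a b) := hlam_cd.continuousOn.mono hIU
  have hlam'_cont : ContinuousOn (deriv lam) (Icc a b) :=
    (hlam_cd.continuousOn_deriv_of_isOpen hU le_rfl).mono hIU
  have hlam_deriv : ∀ τ ∈ Icc a b, HasDerivAt lam (deriv lam τ) τ := fun τ hτ ↦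
    ((hlam_cd.differentiableOn one_ne_zero).differentiableAt (hU.mem_nhds (hIU hτ))).hasDerivAt
  have hβmd : ∀ τ ∈ Icc a b, MDifferentiableAt 𝓘(ℝ, ℝ) ((𝓡 4).prod 𝓘(ℝ, ℝ)) β τ := fun τ hτ ↦
    (hβ.contMDiffAt (hU.mem_nhds (hIU hτ))).mdifferentiableAt one_ne_zero
  have hderiv_eq : ∀ τ ∈ Icc a b,
      deriv lam τ = (mfderiv 𝓘(ℝ, ℝ) ((𝓡 4).prod 𝓘(ℝ, ℝ)) β τ 1).2 := by
    intro τ hτ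
    have h1 := ((hasMFDerivAt_snd (β τ)).comp τ (hβmd τ hτ).hasMFDerivAt).mfderiv
    have h2 : (mfderiv 𝓘(ℝ, ℝ) 𝓘(ℝ, ℝ) lam τ) 1 =
        (mfderiv 𝓘(ℝ, ℝ) ((𝓡 4).prod 𝓘(ℝ, ℝ)) β τ 1).2 := by
      rw [show lam = Prod.snd ∘ β from rfl, h1]; rfl
    rw [mfderiv_eq_fderiv] at h2
    exact h2
  -- the cross-section path `x = fst ∘ β` and its velocity
  set x : ℝ → N := fun τ ↦ (β τ).1 with hx
  have hx_smooth : ContMDiffOn 𝓘(ℝ, ℝ) (𝓡 4) 1 x U := contMDiff_fst.comp_contMDiffOn hβ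
  have hx1 : ContMDiffOn 𝓘(ℝ, ℝ) (𝓡 4) 1 x (Icc a b) := hx_smooth.mono hIU
  have hxderiv : ∀ τ ∈ Icc a b,
      mfderiv 𝓘(ℝ, ℝ) (𝓡 4) x τ 1 = (mfderiv 𝓘(ℝ, ℝ) ((𝓡 4).prod 𝓘(ℝ, ℝ)) β τ 1).1 := by
    intro τ hτ
    have h1 := ((hasMFDerivAt_fst (β τ)).comp τ (hβmd τ hτ).hasMFDerivAt).mfderiv
    have h2 : (mfderiv 𝓘(ℝ, ℝ) (𝓡 4) x τ) 1 = (mfderiv 𝓘(ℝ, ℝ) ((𝓡 4).prod 𝓘(ℝ, ℝ)) β τ 1).1 := by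
      rw [show x = Prod.fst ∘ β from rfl, h1]; rfl
    exact h2
  -- the two speeds `p = |λ'|/λ` and `q = |x'|_{gN}/λ`
  set p : ℝ → ℝ := fun τ ↦ |deriv lam τ| / lam τ with hp
  set q : ℝ → ℝ := fun τ ↦
    Real.sqrt (gN.val (x τ) (mfderiv 𝓘(ℝ, ℝ) (𝓡 4) x τ 1) (mfderiv 𝓘(ℝ, ℝ) (𝓡 4) x τ 1)) / lam τ
    with hq
  have hp_nn : ∀ τ ∈ Icc a b, 0 ≤ p τ := fun τ hτ ↦ div_nonneg (abs_nonneg _) (hpos τ hτ).le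
  have hq_nn : ∀ τ ∈ Icc a b, 0 ≤ q τ := fun τ hτ ↦ div_nonneg (Real.sqrt_nonneg _) (hpos τ hτ).le
  -- pointwise: `κ (p/r + ρ q/r) ≤ |γ'|_G`
  have hΩo : IsOpen (univ ×ˢ Ioo (0 : ℝ) 1 : Set (N × ℝ)) := isOpen_univ.prod isOpen_Ioo
  have hspeed : ∀ τ ∈ Icc a b,
      κ * ((1 / r) * p τ) + κ * ((ρ / r) * q τ) ≤
        Real.sqrt (G.val ((Ψ ∘ β) τ) (mfderiv 𝓘(ℝ, ℝ) (𝓡 5) (Ψ ∘ β) τ 1)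
          (mfderiv 𝓘(ℝ, ℝ) (𝓡 5) (Ψ ∘ β) τ 1)) := by
    intro τ hτ
    have hl := hdeep τ hτ
    have hl0 : 0 < (β τ).2 := hl.1
    have hmem : β τ ∈ (univ ×ˢ Ioo (0 : ℝ) 1 : Set (N × ℝ)) :=
      ⟨mem_univ _, hl.1, hl.2.trans_le ht1⟩
    have hΨ : MDifferentiableAt ((𝓡 4).prod 𝓘(ℝ, ℝ)) (𝓡 5) Ψ (β τ) :=
      (hsm.contMDiffAt (hΩo.mem_nhds hmem)).mdifferentiableAt (by simp)
    rw [mfderiv_comp τ hΨ (hβmd τ hτ)]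
    -- rewrite `p τ`, `q τ` through `u = β'(τ)`
    have hpτ : p τ = |(mfderiv 𝓘(ℝ, ℝ) ((𝓡 4).prod 𝓘(ℝ, ℝ)) β τ 1).2| / (β τ).2 := by
      simp only [hp, hderiv_eq τ hτ]
      rfl
    have hqτ : q τ = Real.sqrt (gN.val (β τ).1 (mfderiv 𝓘(ℝ, ℝ) ((𝓡 4).prod 𝓘(ℝ, ℝ)) β τ 1).1
        (mfderiv 𝓘(ℝ, ℝ) ((𝓡 4).prod 𝓘(ℝ, ℝ)) β τ 1).1) / (β τ).2 := by
      simp only [hq, hxderiv τ hτ]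
      rfl
    rw [hpτ, hqτ]
    set u := mfderiv 𝓘(ℝ, ℝ) ((𝓡 4).prod 𝓘(ℝ, ℝ)) β τ 1 with hu
    have h := hasym (β τ).1 (β τ).2 hl u.1 u.2
    have hlow := sub_mul_le_of_abs_sub_le h
    have hg0 := val_self_nonneg gN hgN (β τ).1 u.1
    set P : ℝ := |u.2| / (β τ).2 with hP
    set Q : ℝ := Real.sqrt (gN.val (β τ).1 u.1 u.1) / (β τ).2 with hQ
    -- `κ² (P² + Q²) = (1-ε) c (σ² + gN(v,v))/l²`
    have hPQ : κ ^ 2 * (P ^ 2 + Q ^ 2) = (1 - ε) * (c * (u.2 ^ 2 + gN.val (β τ).1 u.1 u.1) / (β τ).2 ^ 2) := by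
      rw [hκsq, hP, hQ, div_pow, div_pow, sq_abs, Real.sq_sqrt hg0]
      field_simp
    have hCS : (1 / r) * P + (ρ / r) * Q ≤ Real.sqrt (P ^ 2 + Q ^ 2) :=
      mul_add_mul_le_sqrt_sq_add_sq' hunit P Q
    calc κ * ((1 / r) * P) + κ * ((ρ / r) * Q) = κ * ((1 / r) * P + (ρ / r) * Q) := by ring
      _ ≤ κ * Real.sqrt (P ^ 2 + Q ^ 2) := mul_le_mul_of_nonneg_left hCS hκ0.le
      _ = Real.sqrt (κ ^ 2 * (P ^ 2 + Q ^ 2)) := by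
          rw [Real.sqrt_mul (sq_nonneg κ), Real.sqrt_sq hκ0.le]
      _ ≤ _ := by rw [hPQ]; exact Real.sqrt_le_sqrt hlow
  -- integrate the pointwise bound: `∫⁻ κ p/r + ∫⁻ κ ρ q/r ≤ length ≤ L`
  have hmeas : MeasurableSet (Icc a b) := measurableSet_Icc
  set fp : ℝ → ℝ≥0∞ := fun τ ↦ ENNReal.ofReal (κ * ((1 / r) * p τ)) with hfp
  set fq : ℝ → ℝ≥0∞ := fun τ ↦ ENNReal.ofReal (κ * ((ρ / r) * q τ)) with hfq
  have hp_cont : ContinuousOn p (Icc a b) :=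
    (continuous_abs.comp_continuousOn hlam'_cont).div hlam_cont fun τ hτ ↦ (hpos τ hτ).ne'
  have hfp_meas : AEMeasurable fp (volume.restrict (Icc a b)) := by
    refine ENNReal.measurable_ofReal.comp_aemeasurable ?_
    exact ((continuousOn_const.mul (continuousOn_const.mul hp_cont)).aemeasurable hmeas)
  have hsum : (∫⁻ τ in Icc a b, fp τ) + ∫⁻ τ in Icc a b, fq τ ≤ ENNReal.ofReal L := by
    have hadd : ∫⁻ τ in Icc a b, (fp τ + fq τ) = (∫⁻ τ in Icc a b, fp τ) + ∫⁻ τ in Icc a b, fq τ :=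
      lintegral_add_left' hfp_meas _
    rw [← hadd]
    refine le_trans ?_ hL
    rw [PseudoRiemannianMetric.length_eq_lintegral]
    refine setLIntegral_mono' hmeas fun τ hτ ↦ ?_
    simp only [hfp, hfq]
    rw [← ENNReal.ofReal_add (by have := hp_nn τ hτ; positivity)
      (by have := hq_nn τ hτ; positivity)]
    exact ENNReal.ofReal_le_ofReal (hspeed τ hτ)
  -- the vertical part is at least `κ ℓ / r`
  have hvert : ENNReal.ofReal (κ * ((1 / r) * ℓ)) ≤ ∫⁻ τ in Icc a b, fp τ := by
    have hint : IntegrableOn (fun τ ↦ κ * ((1 / r) * p τ)) (Icc a b) :=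
      (continuousOn_const.mul (continuousOn_const.mul hp_cont)).integrableOn_Icc
    simp only [hfp]
    rw [← ofReal_integral_eq_lintegral_ofReal hint ((ae_restrict_iff' hmeas).2
      (ae_of_all _ fun τ hτ ↦ by have := hp_nn τ hτ; positivity))]
    refine ENNReal.ofReal_le_ofReal ?_
    rw [integral_Icc_eq_integral_Ioc, ← intervalIntegral.integral_of_le hab,
      intervalIntegral.integral_const_mul, intervalIntegral.integral_const_mul]
    refine mul_le_mul_of_nonneg_left (mul_le_mul_of_nonneg_left ?_ (by positivity)) hκ0.le
    exact log_div_le_integral_abs_deriv_div' hab hlam_cont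
      (fun τ hτ ↦ hlam_deriv τ (Ioo_subset_Icc_self hτ)) hlam'_cont hpos
  -- hence the horizontal part is at most `L - κ ℓ / r`
  have hhor : ∫⁻ τ in Icc a b, fq τ ≤ ENNReal.ofReal (L - κ * ((1 / r) * ℓ)) := by
    have hfin : ENNReal.ofReal (κ * ((1 / r) * ℓ)) ≠ ⊤ := ENNReal.ofReal_ne_top
    have h1 : ENNReal.ofReal (κ * ((1 / r) * ℓ)) + ∫⁻ τ in Icc a b, fq τ ≤ ENNReal.ofReal L :=
      (add_le_add hvert le_rfl).trans hsum
    have h2 := ENNReal.le_sub_of_add_le_left hfin h1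
    rwa [← ENNReal.ofReal_sub _ (by positivity)] at h2
  -- `∫⁻ q ≤ (L - κℓ/r) · r/(κρ)`
  have hcoef : 0 < κ * (ρ / r) := by positivity
  have hq_int : ∫⁻ τ in Icc a b, ENNReal.ofReal (q τ) ≤
      ENNReal.ofReal ((L - κ * ((1 / r) * ℓ)) / (κ * (ρ / r))) := by
    have hfq_eq : ∀ τ, fq τ = ENNReal.ofReal (κ * (ρ / r)) * ENNReal.ofReal (q τ) := by
      intro τ
      simp only [hfq]
      rw [← ENNReal.ofReal_mul hcoef.le]
      ring_nf
    have h1 : ∫⁻ τ in Icc a b, fq τ =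
        ENNReal.ofReal (κ * (ρ / r)) * ∫⁻ τ in Icc a b, ENNReal.ofReal (q τ) := by
      simp_rw [hfq_eq]
      rw [lintegral_const_mul' _ _ ENNReal.ofReal_ne_top]
    rw [h1] at hhor
    have h2 : ∫⁻ τ in Icc a b, ENNReal.ofReal (q τ) ≤
        ENNReal.ofReal (L - κ * ((1 / r) * ℓ)) / ENNReal.ofReal (κ * (ρ / r)) := by
      rw [ENNReal.le_div_iff_mul_le (Or.inl ((ENNReal.ofReal_pos.2 hcoef).ne'))
        (Or.inl ENNReal.ofReal_ne_top), mul_comm]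
      exact hhor
    refine h2.trans_eq ?_
    rw [ENNReal.ofReal_div_of_pos hcoef]
  -- the `gN`-length of `x` is at most `s ∫⁻ q`
  have hxlen : gN.length hgN x a b ≤ ENNReal.ofReal s * ∫⁻ τ in Icc a b, ENNReal.ofReal (q τ) := by
    rw [PseudoRiemannianMetric.length_eq_lintegral, ← lintegral_const_mul' _ _ ENNReal.ofReal_ne_top]
    refine setLIntegral_mono' hmeas fun τ hτ ↦ ?_
    rw [← ENNReal.ofReal_mul (le_trans (hpos τ hτ).le (hle τ hτ))]
    refine ENNReal.ofReal_le_ofReal ?_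
    -- `√(gN(x',x')) = λ q ≤ s q`
    have hqτ : Real.sqrt (gN.val (x τ) (mfderiv 𝓘(ℝ, ℝ) (𝓡 4) x τ 1) (mfderiv 𝓘(ℝ, ℝ) (𝓡 4) x τ 1))
        = lam τ * q τ := by
      simp only [hq]
      rw [mul_comm, div_mul_cancel₀ _ (hpos τ hτ).ne']
    rw [hqτ]
    exact mul_le_mul_of_nonneg_right (hle τ hτ) (hq_nn τ hτ)
  -- assemble
  have hs0 : 0 ≤ s := (hpos a ⟨le_rfl, hab⟩).le.trans (hle a ⟨le_rfl, hab⟩)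
  calc gN.edist hgN (β a).1 (β b).1 = gN.edist hgN (x a) (x b) := rfl
    _ ≤ gN.length hgN x a b := PseudoRiemannianMetric.edist_le_length hgN hab hx1
    _ ≤ ENNReal.ofReal s * ∫⁻ τ in Icc a b, ENNReal.ofReal (q τ) := hxlen
    _ ≤ ENNReal.ofReal s * ENNReal.ofReal ((L - κ * ((1 / r) * ℓ)) / (κ * (ρ / r))) := by
        gcongr
    _ = ENNReal.ofReal (s * (r * L - κ * ℓ) / (κ * ρ)) := by
        rw [← ENNReal.ofReal_mul hs0]
        congr 1
        field_simp

end Summit.SmoothPoincare4.SmoothPoincare4.Cruxes.C0AhRecognition.CoreDistanceMorse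

end
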